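import Summits.Ventures.LatticeQCDFlow.Scaling.StartStateDomination
import Summits.Ventures.LatticeQCDFlow.Scaling.AdjacentPairPersistence

/-!
HONEST FRAMING: exact (Metropolis-corrected) sampling algorithms for lattice gauge theory; figures
of merit are autocorrelation/cost numbers at stated couplings and volumes; no continuum-physics
claim.

# StarOccupationComparison — HYPOTHESIS (S2) OF FILE 16 IS DOMINATION FROM THE ★ START: BY REVERSIBILITY OF THE TAIL RESOLVENTS (`m(t₁)ũ_{t₁}(t₀) = m(t₀)ũ_{t₀}(t₁)`) THE
# ★-OCCUPATIONS FROM THE HUB `z` ARE THE `z`-OCCUPATIONS FROM ★ RESCALED BY `W_a`, `W_b`, AND `(1−θ_b)W_a/W_b ≤ 1+θ_b−2θ_a`; SO THE LAW OF ITEM 1 (i) AT EVERY SWAP RATE FOLLOWS FROM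
# ONE STATEMENT — DOMINATION OF THE ORDINARY OCCUPATIONS OF THE TAGGED CHAINS, FROM THE COMMON HUB AND FROM ★ (lean-2 GEN-37, ours)

Venture-side (OURS).  Cell `lqcd-flow` (pub-lqcd), unit `pub-lqcd-lean-2-g37`, 2026-08-29.  Chapter W (item 1 (i) at finite swap odds), file 21.  §1 (generic, reversible `P` w.r.t. `m ≥ 0`
whose null rows do not charge non-null states): two tail resolvents `ũ_{t₀} = (1−σ)P(t₀,·) + σũ_{t₀}P`, `ũ_{t₁} = …` from non-null states satisfy **`m(t₁)ũ_{t₁}(t₀) = m(t₀)ũ_{t₀}(t₁)`**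
(`rowResolvent_reversible`; proof: pair the row equation of `u_{t₁}` with the column resolvent built from `u_{t₀}` in file 20).  §2: for the tagged chains of files 14–16 (`X` tags `a`,
`Y` tags `b`, `W_b ≤ W_a`, common ordinary `N_C`, ordinary hub `z`), `m(★) = 1/W_a` resp. `1/W_b` and `m(z) = N_C(z)/W_z`, so `x̃_z(★) = x̃_★(z)/(W_a m(z))`, `ỹ_z(★) = ỹ_★(z)/(W_b m(z))`
and, since `(1−θ_b)/W_b = pθ_b` and `(1+θ_b−2θ_a) − pW_aθ_b = (1−pW_a)(θ_b−θ_a) ≥ 0`: **DOMINATION FROM ★ AT THE HUB CONTENT (`ỹ_★(z) ≤ x̃_★(z)`) IMPLIES (S2)**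
(`S2_of_star_domination`).  Hence (`adjacent_cost_le_gain_of_domination`) the sharp persistence inequality for an adjacent pair follows from domination alone — from the hub (`ỹ_z ≤ x̃_z` on
ordinary contents, hypothesis (D) of file 16, proved at `w = z` in file 20) and from ★ at `z` — i.e. from MEMO-gen37's single Conjecture M (raising one particle's impersistence lowers every other
particle's discounted hub occupation, from every start).  Hypothesis-equations, no definitions.

## What is proved

* §1 `rowResolvent_full`, **`rowResolvent_reversible`**.
* §2 `tagged_mass_star_swap`, `S2_coefficient_ge`, **`S2_of_star_domination`**, **`adjacent_cost_le_gain_of_domination`**.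

Reading (no numerics implied): the law of item 1 (i) at every swap rate now rests on one monotonicity conjecture about the Metropolis hub chain of `K+1` particles.  NOT CLAIMED: that
conjecture (off the start state).  Literature grade (cell rule): OWN, elementary; nothing cited as a fact; no new bib keys.
-/

open Finset

namespace Summit.Ventures.LatticeQCDFlow.Scaling

/-! ## §1 Reversibility of tail resolvents -/

section RowRev
variable {T : Type*} [Fintype T] [DecidableEq T]
variable {P : T → T → ℝ} {m : T → ℝ} {σ : ℝ}

/-- The full resolvent `u = (1−σ)δ_{t₀} + σũ` solves `u = (1−σ)δ_{t₀} + σuP` when `ũ = (1−σ)P(t₀,·) + σũP`. [ours] -/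
theorem rowResolvent_full {t₀ : T} {ut : T → ℝ} (hut : ∀ t, ut t = (1 - σ) * P t₀ t + σ * ∑ k, ut k * P k t) (t : T) :
    ((1 - σ) * (if t = t₀ then 1 else 0) + σ * ut t)
      = (1 - σ) * (if t = t₀ then 1 else 0) + σ * ∑ k, ((1 - σ) * (if k = t₀ then 1 else 0) + σ * ut k) * P k t := by
  have e : ∑ k, ((1 - σ) * (if k = t₀ then 1 else 0) + σ * ut k) * P k t = (1 - σ) * P t₀ t + σ * ∑ k, ut k * P k t := by
    rw [show (∑ k, ((1 - σ) * (if k = t₀ then 1 else 0) + σ * ut k) * P k t) = ∑ k, ((1 - σ) * ((if k = t₀ then 1 else 0) * P k t) + σ * (ut k * P k t)) from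
      sum_congr rfl fun k _ => by ring, sum_add_distrib, ← mul_sum, ← mul_sum]
    congr 1; simp_rw [ite_mul, one_mul, zero_mul]; rw [Finset.sum_ite_eq' univ t₀]; simp
  rw [e, ← hut t]

/-- **REVERSIBILITY OF TAIL RESOLVENTS:** `m(t₁)·ũ_{t₁}(t₀) = m(t₀)·ũ_{t₀}(t₁)` for two tail resolvents of a reversible kernel from non-null states `t₀ ≠ t₁` (`0 < σ < 1`; null rows
do not charge non-null states). [ours] -/
theorem rowResolvent_reversible (hrev : ∀ h k, m h * P h k = m k * P k h) (hm0 : ∀ h, 0 ≤ m h) (hnull : ∀ t k, m t = 0 → m k ≠ 0 → P t k = 0)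
    (hσ0 : 0 < σ) (hσ1 : σ < 1) {t₀ t₁ : T} (h01 : t₀ ≠ t₁) (hm₀ : 0 < m t₀) (hm₁ : 0 < m t₁)
    {u₀ u₁ : T → ℝ} (hu₀ : ∀ t, u₀ t = (1 - σ) * P t₀ t + σ * ∑ k, u₀ k * P k t) (hu₁ : ∀ t, u₁ t = (1 - σ) * P t₁ t + σ * ∑ k, u₁ k * P k t) :
    m t₁ * u₁ t₀ = m t₀ * u₀ t₁ := by
  classical
  have h1σ : 0 < 1 - σ := by linarith
  -- the column resolvent from `u₀`
  set f : T → ℝ := fun t => m t₀ * ((1 - σ) * (if t = t₀ then 1 else 0) + σ * u₀ t) / ((1 - σ) * m t) with hfdef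
  have hf := rowResolvent_to_column hrev hσ1 hm₀ hm0 hnull hu₀ (f := f) (fun t => rfl)
  -- the full row resolvent from `t₁`
  set v : T → ℝ := fun t => (1 - σ) * (if t = t₁ then 1 else 0) + σ * u₁ t with hvdef
  have hv : ∀ t, v t = (1 - σ) * (if t = t₁ then 1 else 0) + σ * ∑ k, v k * P k t := fun t => rowResolvent_full hu₁ t
  -- pair: `Σ_t v(t)(f(t) − σ(Pf)(t)) = v(t₀)` and `= Σ_k f(k)(v(k) − σ(vP)(k)) = (1−σ)f(t₁)`
  have hA : ∑ t, v t * (f t - σ * ∑ k, P t k * f k) = v t₀ := by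
    have e : ∀ t, f t - σ * ∑ k, P t k * f k = if t = t₀ then 1 else 0 := fun t => by rw [hf t]; ring
    simp_rw [e, mul_ite, mul_one, mul_zero]; rw [Finset.sum_ite_eq' univ t₀]; simp
  have hB : ∑ t, v t * (f t - σ * ∑ k, P t k * f k) = (1 - σ) * f t₁ := by
    have e1 : ∑ t, v t * (f t - σ * ∑ k, P t k * f k) = ∑ t, v t * f t - σ * ∑ k, (∑ t, v t * P t k) * f k := by
      rw [mul_sum]
      have : ∑ k, σ * ((∑ t, v t * P t k) * f k) = ∑ t, v t * (σ * ∑ k, P t k * f k) := by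
        simp_rw [sum_mul, mul_sum]; rw [sum_comm]; exact sum_congr rfl fun t _ => sum_congr rfl fun k _ => by ring
      rw [this, ← sum_sub_distrib]; exact sum_congr rfl fun t _ => by ring
    have e2 : ∀ k, v k - σ * ∑ t, v t * P t k = (1 - σ) * (if k = t₁ then 1 else 0) := fun k => by
      have := hv k; linarith
    rw [e1]
    have e3 : ∑ t, v t * f t - σ * ∑ k, (∑ t, v t * P t k) * f k = ∑ k, (v k - σ * ∑ t, v t * P t k) * f k := by
      rw [mul_sum, ← sum_sub_distrib]; exact sum_congr rfl fun k _ => by ring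
    rw [e3]; simp_rw [e2]; simp_rw [mul_comm ((1 - σ) * _) _, mul_ite, mul_one, mul_zero]
    rw [Finset.sum_ite_eq' univ t₁]; simp; ring
  have hpair : v t₀ = (1 - σ) * f t₁ := by rw [← hA, hB]
  -- evaluate both sides
  have hv0 : v t₀ = σ * u₁ t₀ := by simp [hvdef, h01]
  have hf1 : (1 - σ) * f t₁ = m t₀ * (σ * u₀ t₁) / m t₁ := by
    simp only [hfdef, if_neg (Ne.symm h01), mul_zero, zero_add]; field_simp
  rw [hv0, hf1] at hpair
  have hσne : σ ≠ 0 := hσ0.ne'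
  field_simp at hpair
  linarith [hpair]

end RowRev

/-! ## §2 (S2) from domination at the hub content from the ★ start -/

section StarS2
variable {S : Type*} [Fintype S] [DecidableEq S]
variable {W θ : S → ℝ} {acc : S → S → ℝ} {p σ : ℝ} {K : ℕ} {NC : S → ℕ} {a b z : S}
variable {PX PY : Option S → Option S → ℝ} {xt yt xs ys : Option S → ℝ}

/-- **The ★-occupation from the hub against the hub-content occupation from ★:** `(N_C(z)/W_z)·x̃_z(★) = (1/W_s)·x̃_★(z)` for the tagged chain with tag `s` (`0 < σ < 1`). [ours] -/
theorem tagged_mass_star_swap (hW : ∀ v, 0 < W v) (hacc : ∀ h v, acc h v = min 1 (W h / W v)) {s : S} {P : Option S → Option S → ℝ}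
    (hPoff : ∀ h v, h ≠ v → P (some h) (some v) = if NC h = 0 then 0 else (NC v : ℝ) / K * acc h v)
    (hPin : ∀ h, P (some h) none = if NC h = 0 then 0 else acc h s / K)
    (hPout : ∀ v, P none (some v) = (NC v : ℝ) / K * acc s v)
    (hσ0 : 0 < σ) (hσ1 : σ < 1) (hz : NC z ≠ 0) {ut us : Option S → ℝ}
    (hut : ∀ t, ut t = (1 - σ) * P (some z) t + σ * ∑ t', ut t' * P t' t) (hus : ∀ t, us t = (1 - σ) * P none t + σ * ∑ t', us t' * P t' t) :
    (NC z : ℝ) / W z * ut none = 1 / W s * us (some z) := by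
  set m : Option S → ℝ := fun t => Option.elim t (1 / W s) (fun v => (NC v : ℝ) / W v) with hm
  have hrev := tagged_detailedBalance hW hacc hPoff hPin hPout (m := m) (fun v => by simp [hm]) (by simp [hm])
  have hm0 : ∀ t, 0 ≤ m t := tagged_mass_nonneg (NC := NC) (s := s) hW
  have hnull : ∀ t k, m t = 0 → m k ≠ 0 → P t k = 0 := tagged_null_row (s := s) hW hPoff hPin
  have hmz : 0 < m (some z) := by simp [hm]; exact div_pos (by exact_mod_cast Nat.pos_of_ne_zero hz) (hW z)
  have hms : 0 < m none := by simp [hm]; exact hW s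
  have h := rowResolvent_reversible hrev hm0 hnull hσ0 hσ1 (t₀ := none) (t₁ := some z) (Option.some_ne_none z).symm hms hmz hus hut
  simpa [hm] using h

omit [Fintype S] [DecidableEq S] in
/-- The coefficient inequality of (S2): `(1−θ_b)·W_a/W_b ≤ 1 + θ_b − 2θ_a` (`θ = 1/(1+pW)`, `pW_a ≤ 1`, `W_b ≤ W_a`; the gap is `(1−pW_a)(θ_b−θ_a)`). [ours] -/
theorem S2_coefficient_ge (hW : ∀ v, 0 < W v) (hp0 : 0 ≤ p) (hp : ∀ v, p * W v ≤ 1) (hθ : ∀ v, θ v = 1 / (1 + p * W v)) (hab : W b ≤ W a) :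
    (1 - θ b) * (W a / W b) ≤ 1 + θ b - 2 * θ a := by
  have hWa := hW a; have hWb := hW b
  set A : ℝ := 1 + p * W a with hA
  set B : ℝ := 1 + p * W b with hB
  have hA0 : 0 < A := by rw [hA]; nlinarith [mul_nonneg hp0 hWa.le]
  have hB0 : 0 < B := by rw [hB]; nlinarith [mul_nonneg hp0 hWb.le]
  have hA2 : A ≤ 2 := by rw [hA]; linarith [hp a]
  have hBA : B ≤ A := by rw [hA, hB]; nlinarith [mul_le_mul_of_nonneg_left hab hp0]
  have eL : (1 - θ b) * (W a / W b) = p * W a / B := by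
    rw [hθ b, ← hB]; field_simp; rw [hB]; ring
  have eR : 1 + θ b - 2 * θ a = 1 + 1 / B - 2 / A := by rw [hθ a, hθ b, ← hA, ← hB]; ring
  rw [eL, eR]
  have key : (1 + 1 / B - 2 / A) - p * W a / B = (2 - A) * (A - B) / (A * B) := by
    have : p * W a = A - 1 := by rw [hA]; ring
    rw [this]; field_simp; ring
  have hnum : 0 ≤ (2 - A) * (A - B) / (A * B) := div_nonneg (mul_nonneg (by linarith) (by linarith)) (mul_pos hA0 hB0).le
  linarith

/-- The same identity at every `σ ∈ [0,1)` (at `σ = 0` it is detailed balance itself). [ours] -/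
theorem tagged_mass_star_swap' (hW : ∀ v, 0 < W v) (hacc : ∀ h v, acc h v = min 1 (W h / W v)) {s : S} {P : Option S → Option S → ℝ}
    (hPoff : ∀ h v, h ≠ v → P (some h) (some v) = if NC h = 0 then 0 else (NC v : ℝ) / K * acc h v)
    (hPin : ∀ h, P (some h) none = if NC h = 0 then 0 else acc h s / K)
    (hPout : ∀ v, P none (some v) = (NC v : ℝ) / K * acc s v)
    (hσ0 : 0 ≤ σ) (hσ1 : σ < 1) (hz : NC z ≠ 0) {ut us : Option S → ℝ}
    (hut : ∀ t, ut t = (1 - σ) * P (some z) t + σ * ∑ t', ut t' * P t' t) (hus : ∀ t, us t = (1 - σ) * P none t + σ * ∑ t', us t' * P t' t) :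
    (NC z : ℝ) / W z * ut none = 1 / W s * us (some z) := by
  rcases eq_or_lt_of_le hσ0 with hσ | hσpos
  · subst hσ
    have e1 : ut none = P (some z) none := by rw [hut]; simp
    have e2 : us (some z) = P none (some z) := by rw [hus]; simp
    set m : Option S → ℝ := fun t => Option.elim t (1 / W s) (fun v => (NC v : ℝ) / W v) with hm
    have hrev := tagged_detailedBalance hW hacc hPoff hPin hPout (m := m) (fun v => by simp [hm]) (by simp [hm])
    have h := hrev (some z) none
    rw [e1, e2]; simpa [hm] using h
  · exact tagged_mass_star_swap hW hacc hPoff hPin hPout hσpos hσ1 hz hut hus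

/-- **(S2) FROM DOMINATION FROM THE ★ START:** if the tagged tail laws from ★ satisfy `ỹ_★(z) ≤ x̃_★(z)` at the hub content, then `(1−θ_b)·ỹ_z(★) ≤ (1+θ_b−2θ_a)·x̃_z(★)`
(`W_b ≤ W_a`, `pW ≤ 1`). [ours] -/
theorem S2_of_star_domination (hW : ∀ v, 0 < W v) (hp0 : 0 ≤ p) (hp : ∀ v, p * W v ≤ 1) (hθ : ∀ v, θ v = 1 / (1 + p * W v))
    (hacc : ∀ h v, acc h v = min 1 (W h / W v)) (hK : 1 ≤ K) (hNC : ∑ v, NC v = K) (hab : W b ≤ W a)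
    (hPXoff : ∀ h v, h ≠ v → PX (some h) (some v) = if NC h = 0 then 0 else (NC v : ℝ) / K * acc h v)
    (hPXin : ∀ h, PX (some h) none = if NC h = 0 then 0 else acc h a / K)
    (hPXdiag : ∀ h, PX (some h) (some h) = 1 - (∑ v ∈ univ.erase h, PX (some h) (some v) + PX (some h) none))
    (hPXout : ∀ v, PX none (some v) = (NC v : ℝ) / K * acc a v) (hPXstay : PX none none = 1 - ∑ v, PX none (some v))
    (hPYoff : ∀ h v, h ≠ v → PY (some h) (some v) = if NC h = 0 then 0 else (NC v : ℝ) / K * acc h v)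
    (hPYin : ∀ h, PY (some h) none = if NC h = 0 then 0 else acc h b / K)
    (hPYout : ∀ v, PY none (some v) = (NC v : ℝ) / K * acc b v)
    (hσ0 : 0 ≤ σ) (hσ1 : σ < 1) (hz : NC z ≠ 0)
    (hxt : ∀ t, xt t = (1 - σ) * PX (some z) t + σ * ∑ t', xt t' * PX t' t) (hyt : ∀ t, yt t = (1 - σ) * PY (some z) t + σ * ∑ t', yt t' * PY t' t)
    (hxs : ∀ t, xs t = (1 - σ) * PX none t + σ * ∑ t', xs t' * PX t' t) (hys : ∀ t, ys t = (1 - σ) * PY none t + σ * ∑ t', ys t' * PY t' t)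
    (hDstar : ys (some z) ≤ xs (some z)) :
    (1 - θ b) * yt none ≤ (1 + θ b - 2 * θ a) * xt none := by
  have hX := tagged_mass_star_swap' hW hacc hPXoff hPXin hPXout hσ0 hσ1 hz hxt hxs
  have hY := tagged_mass_star_swap' hW hacc hPYoff hPYin hPYout hσ0 hσ1 hz hyt hys
  have hmz : 0 < (NC z : ℝ) / W z := div_pos (by exact_mod_cast Nat.pos_of_ne_zero hz) (hW z)
  have hWa := hW a; have hWb := hW b
  -- `yt(★) ≤ (W_a/W_b)·xt(★)`
  have h1 : yt none ≤ W a / W b * xt none := by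
    have h1' : (NC z : ℝ) / W z * yt none ≤ (NC z : ℝ) / W z * (W a / W b * xt none) := by
      rw [hY]
      have e1 : (NC z : ℝ) / W z * (W a / W b * xt none) = W a / W b * ((NC z : ℝ) / W z * xt none) := by ring
      rw [e1, hX]
      have e2 : W a / W b * (1 / W a * xs (some z)) = 1 / W b * xs (some z) := by field_simp
      rw [e2]
      exact mul_le_mul_of_nonneg_left hDstar (by positivity)
    exact le_of_mul_le_mul_left h1' hmz
  -- signs and the coefficient inequality
  have hxt0 : 0 ≤ xt none := by
    have hP0 := tagged_nonneg hW hacc hPXoff hPXin hPXdiag hPXout hPXstay hK hNC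
    have hP1 := tagged_rowsum (P := PX) hPXdiag hPXstay
    exact geomResolvent_nonneg hP0 hP1 hσ0 hσ1 (ν := fun t => PX (some z) t) (fun t => hP0 _ _) hxt none
  have hθb : θ b ≤ 1 := (theta_mem hW hp0 hp hθ b).2
  have hcoef := S2_coefficient_ge hW hp0 hp hθ hab
  calc (1 - θ b) * yt none ≤ (1 - θ b) * (W a / W b * xt none) := mul_le_mul_of_nonneg_left h1 (by linarith)
    _ = ((1 - θ b) * (W a / W b)) * xt none := by ring
    _ ≤ (1 + θ b - 2 * θ a) * xt none := mul_le_mul_of_nonneg_right hcoef hxt0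

variable {KX KY : S → S → ℝ} {NX NY : S → ℕ} {utX utY : S → ℝ}

/-- **THE SHARP PERSISTENCE INEQUALITY FOR AN ADJACENT PAIR FROM DOMINATION ALONE** (from the hub on every ordinary content, and from ★ at the hub content):
`cost(ũ_X) + cost(ũ_Y) ≤ G(ũ_X,ũ_Y)·(2K + M_X + M_Y)`. [ours] -/
theorem adjacent_cost_le_gain_of_domination (hW : ∀ v, 0 < W v) (hp0 : 0 ≤ p) (hp : ∀ v, p * W v ≤ 1) (hθ : ∀ v, θ v = 1 / (1 + p * W v))
    (hacc : ∀ h v, acc h v = min 1 (W h / W v)) (hK : 1 ≤ K) (hNC : ∑ v, NC v = K) (hab : a ≠ b) (hWab : W b ≤ W a)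
    (hX : NX = NC + Pi.single a 1) (hY : NY = NC + Pi.single b 1) (hz : NC z ≠ 0)
    (hPXoff : ∀ h v, h ≠ v → PX (some h) (some v) = if NC h = 0 then 0 else (NC v : ℝ) / K * acc h v)
    (hPXin : ∀ h, PX (some h) none = if NC h = 0 then 0 else acc h a / K)
    (hPXdiag : ∀ h, PX (some h) (some h) = 1 - (∑ v ∈ univ.erase h, PX (some h) (some v) + PX (some h) none))
    (hPXout : ∀ v, PX none (some v) = (NC v : ℝ) / K * acc a v) (hPXstay : PX none none = 1 - ∑ v, PX none (some v))
    (hPYoff : ∀ h v, h ≠ v → PY (some h) (some v) = if NC h = 0 then 0 else (NC v : ℝ) / K * acc h v)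
    (hPYin : ∀ h, PY (some h) none = if NC h = 0 then 0 else acc h b / K)
    (hPYdiag : ∀ h, PY (some h) (some h) = 1 - (∑ v ∈ univ.erase h, PY (some h) (some v) + PY (some h) none))
    (hPYout : ∀ v, PY none (some v) = (NC v : ℝ) / K * acc b v) (hPYstay : PY none none = 1 - ∑ v, PY none (some v))
    (hKXoff : ∀ h v, h ≠ v → KX h v = if NX h = 0 then 0 else (NX v : ℝ) / K * acc h v) (hKXdiag : ∀ h, KX h h = 1 - ∑ v ∈ univ.erase h, KX h v)
    (hKYoff : ∀ h v, h ≠ v → KY h v = if NY h = 0 then 0 else (NY v : ℝ) / K * acc h v) (hKYdiag : ∀ h, KY h h = 1 - ∑ v ∈ univ.erase h, KY h v)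
    (hσ0 : 0 ≤ σ) (hσ1 : σ < 1)
    (hxt : ∀ t, xt t = (1 - σ) * PX (some z) t + σ * ∑ t', xt t' * PX t' t) (hyt : ∀ t, yt t = (1 - σ) * PY (some z) t + σ * ∑ t', yt t' * PY t' t)
    (hxs : ∀ t, xs t = (1 - σ) * PX none t + σ * ∑ t', xs t' * PX t' t) (hys : ∀ t, ys t = (1 - σ) * PY none t + σ * ∑ t', ys t' * PY t' t)
    (hutX : ∀ w, utX w = (1 - σ) * KX z w + σ * ∑ h, utX h * KX h w) (hutY : ∀ w, utY w = (1 - σ) * KY z w + σ * ∑ h, utY h * KY h w)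
    (hdom : ∀ w, yt (some w) ≤ xt (some w)) (hDstar : ys (some z) ≤ xs (some z)) :
    ∑ w, utX w * (1 - θ w) + ∑ w, utY w * (1 - θ w)
      ≤ (∑ w, utX w * (if NY w < NX w then (1 : ℝ) else 0) - ∑ w, utY w * (if NY w < NX w then (1 : ℝ) else 0)
            - ∑ w, max (utY w - utX w) 0 * (if NX w = NY w then (1 : ℝ) else 0))
          * (2 * K + ∑ v, θ v * (NX v : ℝ) + ∑ v, θ v * (NY v : ℝ)) :=
  adjacent_cost_le_gain hW hp0 hp hθ hacc hK hNC hab hX hY hz hPXoff hPXin hPXdiag hPXout hPXstay hPYoff hPYin hPYdiag hPYout hPYstay hKXoff hKXdiag hKYoff hKYdiag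
    hσ0 hσ1 hxt hyt hutX hutY hdom
    (S2_of_star_domination hW hp0 hp hθ hacc hK hNC hWab hPXoff hPXin hPXdiag hPXout hPXstay hPYoff hPYin hPYout hσ0 hσ1 hz hxt hyt hxs hys hDstar)

end StarS2

end Summit.Ventures.LatticeQCDFlow.Scaling
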